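import Literature.Computability.Cryptography.RegevSamplerInnerKernel
import HarnessLib

/-!
# Regev 2009, Lemma 3.14 — the inner family on the STANDARD DATA: the guard discharged, the sizes chosen

`RegevSamplerInnerKernel` proves the per-block bound of Lemma 3.14 for the inner family `innerFamily Rf` on the
standard word, under a size record `(e, T, m, L, Lq, np, p₀)`, a padding amount `wpad` passing the thirteen-conjunct
guard `Guard Rf s N`, and four bookkeeping equations (`|Fq| = Lq`, `|pcode P| ≤ np`, `|Fq| + |⟨pall⟩| + g = p₀`,
`|uz| = L`).  This file CHOOSES those sizes as explicit functions of the instance and the level and DISCHARGES the guard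
once and for all:

* `stdL`, `stdSz`, `stdPad`, `stdNp` — the standard input-zone length (room for the query prefix, the three register
  images and the parameter word), size record, padding amount (the sum of the six wire thresholds of the guard, plus
  one) and parameter-word length (room for the clamped table's word AND the null word);
* `guard_lenCode_of_stdPad_le`, `guard_stdSz`, **`guard_inhabited`** — the guard holds on the length code of the
  standard record for EVERY solver family `Rf` and all dimensions / exponents / precisions / prefix lengths / offsets
  (the non-vacuity of the hypothesis `hG` of `tvDist_innerFamily_kernel_le`, referee item R-78.2), and on such a length
  the inner family's circuit IS the guarded machine circuit (`circ_innerFamily_lenCode_stdSz`);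
* `FqOf`, `npOf`, `machOf`, `p₀Of`, `sizesOf`, `padOf`, `uzOf`, `NOf`, **`stdWordOf`** — the canonical query prefix of a
  level, the clamped level machine, the standard sizes of an instance at a level, the padded input zone and THE standard
  input word of the inner family, with `length_uzOf`, `length_stdWordOf`, `szOf_NOf`, `guard_sizesOf`;
* **`tvDist_innerFamily_kernel_stdWordOf_le`** — Lemma 3.14 per block for `innerFamily Rf` on `stdWordOf …` with ONLY the
  analytic hypotheses left (nonsingular `B`, `n ≥ 5`, `|code B| ≤ e`, precision `m ≥ schedL n e T 0 + 13`, the width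
  window `2^{-T} ≤ √2ρ√n/aq ≤ 2^T`, the promise `aq/(√2ρ) < λ₁(L(B)^*)/2`), the fail weight taken under the layout-free
  data law `failLawOf` (the query data do not depend on the zone lengths, `cOf_schedLayout_eq`).

What this is NOT: the classical pre- and post-processors of the wrapped family and the assembly of
`regev2009_lemma_3_14_stepFamily` (A_q14) are not in this file; A_q14 stays a named fact.
-/

noncomputable section

namespace Literature.Computability.Cryptography

namespace Regev2009

namespace SamplerRegs

open Literature.Algebra.EuclideanLattices Literature.Algebra.EuclideanLattices.Regev2009
  Literature.Algebra.EuclideanLattices.Regev2009.QPart Literature.Computability.QuantumComplexity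
  Literature.Computability.QuantumComplexity.GaussianCells Literature.Computability.QuantumComplexity.GroverRudolph
  Literature.Computability.QuantumComplexity.GRWord Literature.Computability.QuantumComplexity.QFTQubits
  Literature.Computability.QuantumComplexity.QFTWord Literature.Computability.QuantumComplexity.TidyBlockFn
  Literature.Computability.QuantumComplexity.QState Literature.Computability.QuantumComplexity.GRMassTable
  Literature.Computability.QuantumComplexity.GRTableMach
  Literature.Computability.Complexity Literature.LinearAlgebra.Matrix.Berkowitz Peikert2009 Finset _root_.Matrix SamplerArith
  SamplerScale SamplerGeom SamplerWords SamplerWordFns SamplerFormats SamplerQuery CVPOracle SamplerClassical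
  SamplerClassical.Layout SamplerSubst SamplerDecode _root_.Computability Module
open Literature.Computability.QuantumComplexity.GRCosineMach (pcode abs_cosA_le_one cosA_update)
open scoped Real

/-! ### The standard sizes -/

/-- **The standard input-zone length**: room for the query prefix, the cell / branch / residue register images and the
parameter word at offset `p₀`. [cite: Regev2009, Lemma 3.14 (proof: the registers)] -/
def stdL (n e T m Lq np p₀ : ℕ) : ℕ :=
  Lq + n * schedL n e T m + n * schedY n e + n * schedR n e T m + (p₀ + np)

/-- **The standard size record** of dimension `n`, code bound `e`, width exponent `T`, precision `m`, prefix length `Lq`,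
parameter-word length `np` and parameter offset `p₀`. [cite: Regev2009, Lemma 3.14 (proof)] -/
def stdSz (n e T m Lq np p₀ : ℕ) : Sz := ⟨n, e, T, m, stdL n e T m Lq np p₀, Lq, np, p₀⟩

/-- **The standard padding amount**: the sum of the six wire thresholds of the guard, plus one. [cite: AroraBarak2009, §6.2 (padding)] -/
def stdPad (Rf : UniformQCircuitFamily) (s : Sz) : ℕ :=
  topY s.n s.sL s.sY s.sR s.sB s.L s.Lq + topS s.n s.sL s.sY s.sR s.sB s.L s.Lq + topX s.n s.sL s.sY s.sR s.sB s.L s.Lq +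
    (s.base + s.n * QFTKit.qbsize s.sR (2 * s.m + 4)) + (s.base + (s.kq + Rf.family.ancillas s.kq)) +
    (s.base + s.n * GRData.B s.sL s.np (GRTableMach.wlen LevelCode.clamp s.sL s.np) (2 * s.m + 1 + 1)) + 1

/-- **The standard parameter-word length**: room for the word of the clamped table with shape `S` AND for the null word
(`S = 0`, the guard's eleventh conjunct). [cite: Regev2009, Lemma 3.12 (proof)] -/
def stdNp (S : ℚ) (m ℓ : ℕ) : ℕ :=
  (pcode ((S, (4 * (2 * m + ℓ + 3), 6 * (4 * (2 * m + ℓ + 3) + ℓ + 3))), (2 * m + 1, ℓ))).length +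
    (pcode (((0 : ℚ), (4 * (2 * m + ℓ + 3), 6 * (4 * (2 * m + ℓ + 3) + ℓ + 3))), (2 * m + 1, ℓ))).length

/-! ### The guard, discharged -/

/-- **The guard holds on a length code with enough padding**: given the five zone inequalities and the parameter-word
room, any `wpad ≥ stdPad Rf s` makes `Guard Rf s (lenCode s wpad)` true (the length code dominates its padding amount,
`le_lenCode`). [cite: AroraBarak2009, §6.2 and proof of Thm. 6.15 (padding)] -/
theorem guard_lenCode_of_stdPad_le (Rf : UniformQCircuitFamily) (s : Sz) (h2 : s.Lq ≤ s.L) (h3 : s.n * s.sL ≤ s.L)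
    (h4 : s.n * s.sY ≤ s.L) (h5 : s.n * s.sR ≤ s.L)
    (h11 : (pcode (((0 : ℚ), (s.pp, s.UU)), (2 * s.m + 1, s.sL))).length ≤ s.np) (h12 : s.p₀ + s.np ≤ s.L)
    {wpad : ℕ} (hw : stdPad Rf s ≤ wpad) : Guard Rf s (lenCode s wpad) := by
  have hN : wpad ≤ lenCode s wpad := le_lenCode s wpad
  unfold stdPad at hw
  refine ⟨by omega, h2, h3, h4, h5, by omega, by omega, by omega, by omega, by omega, h11, h12, by omega⟩

/-- **The guard holds on the standard record.** [cite: Regev2009, Lemma 3.14 (proof)] -/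
theorem guard_stdSz (Rf : UniformQCircuitFamily) (n e T m Lq p₀ : ℕ) (S : ℚ) {np : ℕ} (hnp : stdNp S m (schedL n e T m) ≤ np)
    {wpad : ℕ} (hw : stdPad Rf (stdSz n e T m Lq np p₀) ≤ wpad) :
    Guard Rf (stdSz n e T m Lq np p₀) (lenCode (stdSz n e T m Lq np p₀) wpad) := by
  refine guard_lenCode_of_stdPad_le Rf _ ?_ ?_ ?_ ?_ ?_ ?_ hw
  · show Lq ≤ stdL n e T m Lq np p₀; unfold stdL; omega
  · show n * schedL n e T m ≤ stdL n e T m Lq np p₀; unfold stdL; omega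
  · show n * schedY n e ≤ stdL n e T m Lq np p₀; unfold stdL; omega
  · show n * schedR n e T m ≤ stdL n e T m Lq np p₀; unfold stdL; omega
  · exact (Nat.le_add_left _ _).trans hnp
  · show p₀ + np ≤ stdL n e T m Lq np p₀; unfold stdL; omega

/-- **Non-vacuity of the guard (R-78.2).** For every solver family and all `n, e, T, m, Lq, p₀` and table shape `S` there is a
register width `N` decoding to the standard record and passing the guard. [cite: Regev2009, Lemma 3.14 (proof)] -/
theorem guard_inhabited (Rf : UniformQCircuitFamily) (n e T m Lq p₀ : ℕ) (S : ℚ) :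
    ∃ N : ℕ, szOf N = stdSz n e T m Lq (stdNp S m (schedL n e T m)) p₀ ∧
      Guard Rf (stdSz n e T m Lq (stdNp S m (schedL n e T m)) p₀) N :=
  ⟨_, szOf_lenCode _ _, guard_stdSz Rf n e T m Lq p₀ S le_rfl le_rfl⟩

/-- **On the standard length code the inner family's circuit is the guarded machine circuit** (not the identity
fallback). [cite: Regev2009, Lemma 3.14 (proof)] [cite: BernsteinVazirani1997, §8] -/
theorem circ_innerFamily_lenCode_stdSz (Rf : UniformQCircuitFamily) (n e T m Lq p₀ : ℕ) (S : ℚ) {np : ℕ}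
    (hnp : stdNp S m (schedL n e T m) ≤ np) {wpad : ℕ} (hw : stdPad Rf (stdSz n e T m Lq np p₀) ≤ wpad) :
    ∃ h : Guard Rf (szOf (lenCode (stdSz n e T m Lq np p₀) wpad)) (lenCode (stdSz n e T m Lq np p₀) wpad),
      (innerFamily Rf).circ (lenCode (stdSz n e T m Lq np p₀) wpad) =
        guardedCirc Rf (szOf (lenCode (stdSz n e T m Lq np p₀) wpad)) (lenCode (stdSz n e T m Lq np p₀) wpad) h := by
  have h : Guard Rf (szOf (lenCode (stdSz n e T m Lq np p₀) wpad)) (lenCode (stdSz n e T m Lq np p₀) wpad) := by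
    rw [szOf_lenCode]; exact guard_stdSz Rf n e T m Lq p₀ S hnp hw
  exact ⟨h, circ_innerFamily_of_guard Rf h⟩

/-- A decided instance: dimension `5`, code bound `40`, width exponent `300`, precision `353`, a `1000`-bit prefix,
offset `2000`, table shape `1`. [cite: Regev2009, Lemma 3.14 (proof)] -/
example (Rf : UniformQCircuitFamily) :
    ∃ N : ℕ, szOf N = stdSz 5 40 300 353 1000 (stdNp 1 353 (schedL 5 40 300 353)) 2000 ∧
      Guard Rf (stdSz 5 40 300 353 1000 (stdNp 1 353 (schedL 5 40 300 353)) 2000) N :=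
  guard_inhabited Rf 5 40 300 353 1000 2000 1

/-! ### The standard data of an instance at a level -/

section Std

variable (I : LatticeInstance) (e T m : ℕ) (aq ρ : ℚ)

/-- The Grover–Rudolph parameter of the clamped level table: shape `Spar`, precision `p = 4(2m+ℓ+3)`, clamp budget
`U = 6(p+ℓ+3)`, `2m+1` levels of width `ℓ = schedL`. [cite: Regev2009, Lemma 3.12 (proof)] -/
def grParOf : GRCosineMach.Par :=
  ((Spar (2 ^ schedR I.n e T m) (detA I) aq ρ I.n, (4 * (2 * m + schedL I.n e T m + 3),
    6 * (4 * (2 * m + schedL I.n e T m + 3) + schedL I.n e T m + 3))), (2 * m + 1, schedL I.n e T m))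

/-- **The parameter-word length of an instance**: `stdNp` at the instance's shape. [cite: Regev2009, Lemma 3.12 (proof)] -/
def npOf : ℕ := stdNp (Spar (2 ^ schedR I.n e T m) (detA I) aq ρ I.n) m (schedL I.n e T m)

/-- The table's word fits in the parameter word. [cite: Regev2009, Lemma 3.12 (proof)] -/
theorem length_pcode_grParOf_le : (pcode (grParOf I e T m aq ρ)).length ≤ npOf I e T m aq ρ := Nat.le_add_right _ _

/-- **The clamped level machine of an instance.** [cite: Regev2009, Lemma 3.12 (proof)] -/
def machOf :=
  mach LevelCode.clamp (Spar (2 ^ schedR I.n e T m) (detA I) aq ρ I.n) (4 * (2 * m + schedL I.n e T m + 3))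
    (6 * (4 * (2 * m + schedL I.n e T m + 3) + schedL I.n e T m + 3)) (2 * m + 1) (schedL I.n e T m) (npOf I e T m aq ρ)
    (length_pcode_grParOf_le I e T m aq ρ)

variable (r : ℚ) (k : ℕ) (y : List Bool) (e' : ℚ) (g : ℕ)

/-- **The canonical query prefix of level `k`**: `⟨⟨⟨x_r, ⟨1^{k+1}, y⟩⟩, ⟨bin ℓ_R, bin b_c⟩⟩, ε⟩`. [cite: Regev2009, Lemma 3.14 (proof: the oracle call)] -/
def FqOf : List Bool :=
  boolPair (boolPair (stageInput (GapSVPInstance.encode (I, r)) (k + 1) y)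
    (boolPair (encodeNat (schedR I.n e T m)) (encodeNat (schedB I.n e T)))) []

/-- **The parameter offset**: after the query prefix, the machine-parameter code and `g` spare zeros. [folklore] -/
def p₀Of : ℕ := (FqOf I e T m r k y).length + (boolPair (pallE ((parOf I, 2 ^ schedR I.n e T m), e')) []).length + g

/-- **The standard sizes of an instance at a level.** [cite: Regev2009, Lemma 3.14 (proof)] -/
def sizesOf : Sz := stdSz I.n e T m (FqOf I e T m r k y).length (npOf I e T m aq ρ) (p₀Of I e T m r k y e' g)

/-- The zero padding filling the input zone. [folklore] -/
def padOf : List Bool :=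
  List.replicate ((sizesOf I e T m aq ρ r k y e' g).L - (p₀Of I e T m r k y e' g + npOf I e T m aq ρ)) false

/-- **The padded input zone**: query prefix, machine parameters, `g` zeros, the table's parameter word, zeros. [cite: Regev2009, Lemma 3.14 (proof)] -/
def uzOf : List Bool :=
  zoneOf (FqOf I e T m r k y) ((parOf I, 2 ^ schedR I.n e T m), e') (padWord g (machOf I e T m aq ρ).c (padOf I e T m aq ρ r k y e' g))

/-- The padded input zone has the standard length. [cite: Regev2009, Lemma 3.14 (proof: the registers)] -/
theorem length_uzOf : (uzOf I e T m aq ρ r k y e' g).length = (sizesOf I e T m aq ρ r k y e' g).L := by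
  have hL : (sizesOf I e T m aq ρ r k y e' g).L =
      stdL I.n e T m (FqOf I e T m r k y).length (npOf I e T m aq ρ) (p₀Of I e T m r k y e' g) := rfl
  have hle : p₀Of I e T m r k y e' g + npOf I e T m aq ρ ≤ (sizesOf I e T m aq ρ r k y e' g).L := by
    rw [hL]; unfold stdL; omega
  rw [uzOf, length_zoneOf_padWord _ _ g _ _ (p₀ := p₀Of I e T m r k y e' g) rfl, padOf, List.length_replicate]
  omega

variable (Rf : UniformQCircuitFamily)

/-- **The register width**: the length code of the standard sizes with the standard padding. [cite: AroraBarak2009, §6.2 (padding)] -/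
def NOf : ℕ := lenCode (sizesOf I e T m aq ρ r k y e' g) (stdPad Rf (sizesOf I e T m aq ρ r k y e' g))

/-- The register width decodes to the standard sizes. [cite: AroraBarak2009, §6.2 and proof of Thm. 6.15 (padding)] -/
theorem szOf_NOf : szOf (NOf I e T m aq ρ r k y e' g Rf) = sizesOf I e T m aq ρ r k y e' g := szOf_lenCode _ _

/-- **The guard holds at the register width.** [cite: Regev2009, Lemma 3.14 (proof)] -/
theorem guard_sizesOf : Guard Rf (sizesOf I e T m aq ρ r k y e' g) (NOf I e T m aq ρ r k y e' g Rf) :=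
  guard_stdSz Rf _ _ _ _ _ _ _ le_rfl le_rfl

/-- **THE STANDARD INPUT WORD of the inner family** for instance `B`, sizes `(e, T, m)`, scale data `(aq, ρ)`, level
`(r, k, y)`, spare rational `e'` and gap `g`: on the schedule layout of width `NOf`, the padded input zone in the zone `U`
and the initial data word of the clamped level machine in every Grover–Rudolph block. [cite: Regev2009, Lemma 3.14 (proof)] -/
def stdWordOf : List Bool :=
  stdWord I (schedLayout I.n e T m (sizesOf I e T m aq ρ r k y e' g).L (FqOf I e T m r k y).length
      (NOf I e T m aq ρ r k y e' g Rf) (guard_sizesOf I e T m aq ρ r k y e' g Rf).1)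
    (uzOf I e T m aq ρ r k y e' g) (List.ofFn (GRData.init (machOf I e T m aq ρ)))

/-- The standard input word has the register width. [cite: Regev2009, Lemma 3.14 (proof: the registers)] -/
theorem length_stdWordOf : (stdWordOf I e T m aq ρ r k y e' g Rf).length = NOf I e T m aq ρ r k y e' g Rf := by
  have hG := guard_sizesOf I e T m aq ρ r k y e' g Rf
  refine length_stdWord I (stdLayout_T I.n _ _ _ _ _ _ _ hG.1).symm (length_uzOf I e T m aq ρ r k y e' g) ?_
  rw [List.length_ofFn]
  exact hG.2.2.2.2.2.2.2.2.2.2.2.2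

variable [IsZLattice ℝ I.lattice] [NeZero I.n]

open Classical in
/-- **The data law of the fail weight**, layout-free: the query data of a box point depend on the schedule only
(`cOf_schedLayout_eq`), so the law is taken on the schedule layout with zone lengths `0` and width `1`. [cite: Regev2009, Lemma 3.14 (proof)] -/
def failLawOf : PMF (QData I.n) :=
  dataLaw (boxSet I.n (schedL I.n e T m) (DT I (2 ^ schedR I.n e T m) (tW (aq : ℝ) (ρ : ℝ) I.n)))
    (fun x => (gaussianFunction 1 x / zBox (boxSet I.n (schedL I.n e T m) (DT I (2 ^ schedR I.n e T m) (tW (aq : ℝ) (ρ : ℝ) I.n)))) ^ 2)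
    (fun _ _ => sq_nonneg _)
    (sum_boxWeight_eq_one (boxSet_nonempty I.n (schedL I.n e T m) (DT I (2 ^ schedR I.n e T m) (tW (aq : ℝ) (ρ : ℝ) I.n))))
    (cOf I (schedLayout I.n e T m 0 0 1 Nat.one_pos) (tW (aq : ℝ) (ρ : ℝ) I.n))

open Classical in
/-- **Regev 2009, Lemma 3.14 — the per-block bound for the inner family on its STANDARD INPUT WORD**, with the guard and
the size bookkeeping discharged: for a nonsingular `B` (`n ≥ 5`, `|code B| ≤ e`, `n ≤ e`, `2 ≤ e`), precision
`m ≥ schedL n e T 0 + 13`, positive rationals `aq, ρ` with `2^{-T} ≤ √2ρ√n/aq ≤ 2^T` and the promise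
`aq/(√2ρ) < λ₁(L(B)^*)/2`, the law of the residue vector read off the output of `innerFamily Rf` on `stdWordOf …` and decoded
by `decZ` is within `8·√(weightedFail Rf B r k y (aq/(√2ρ)) failLawOf) + νlevel(n)` of `intCoords_* D_{L(B), ρ√n/aq}`.
[cite: Regev2009, Lemma 3.14 (statement and proof), Lemma 3.12 (proof)] [cite: NielsenChuang2010, §2.2.5, §4.5]
[cite: BernsteinVazirani1997, §8] -/
theorem tvDist_innerFamily_kernel_stdWordOf_le (hI : I.IsNonsingular) (he : I.encode.length ≤ e) (hne : I.n ≤ e) (he2 : 2 ≤ e)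
    (hn5 : 5 ≤ I.n) (hm : schedL I.n e T 0 + 13 ≤ m) (haq : 0 < aq) (hρ : 0 < ρ)
    (htT : tW (aq : ℝ) (ρ : ℝ) I.n ≤ (2 : ℝ) ^ T) (hTt : (2⁻¹ : ℝ) ^ T ≤ tW (aq : ℝ) (ρ : ℝ) I.n)
    (hprom : (aq : ℝ) / (Real.sqrt 2 * ρ) < minNorm (dualLattice I.lattice) / 2) :
    (((innerFamily Rf).kernel 0 (stdWordOf I e T m aq ρ r k y e' g Rf)).map
        (listDecS I (schedR I.n e T m) (I.n * schedL I.n e T m + (sizesOf I e T m aq ρ r k y e' g).L + I.n * schedY I.n e))).tvDist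
      ((discreteGaussian I.lattice ((ρ : ℝ) * Real.sqrt I.n / aq) 0).map I.intCoords) ≤
      8 * Real.sqrt (weightedFail Rf I r k y ((aq : ℝ) / (Real.sqrt 2 * ρ)) (failLawOf I e T m aq ρ)).toReal + νlevel I.n := by
  have hG : Guard Rf ⟨I.n, e, T, m, stdL I.n e T m (FqOf I e T m r k y).length (npOf I e T m aq ρ) (p₀Of I e T m r k y e' g),
      (FqOf I e T m r k y).length, npOf I e T m aq ρ, p₀Of I e T m r k y e' g⟩
      (lenCode ⟨I.n, e, T, m, stdL I.n e T m (FqOf I e T m r k y).length (npOf I e T m aq ρ) (p₀Of I e T m r k y e' g),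
        (FqOf I e T m r k y).length, npOf I e T m aq ρ, p₀Of I e T m r k y e' g⟩ (stdPad Rf (sizesOf I e T m aq ρ r k y e' g))) :=
    guard_sizesOf I e T m aq ρ r k y e' g Rf
  have h := tvDist_innerFamily_kernel_le I e T m
    (stdL I.n e T m (FqOf I e T m r k y).length (npOf I e T m aq ρ) (p₀Of I e T m r k y e' g))
    (FqOf I e T m r k y).length (npOf I e T m aq ρ) (p₀Of I e T m r k y e' g) (stdPad Rf (sizesOf I e T m aq ρ r k y e' g)) Rf hG
    hI he hne he2 hn5 hm aq ρ haq hρ htT hTt hprom r k y e' (FqOf I e T m r k y) (padOf I e T m aq ρ r k y e' g) rfl rfl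
    (length_pcode_grParOf_le I e T m aq ρ) g rfl (length_uzOf I e T m aq ρ r k y e' g) 0
  rw [cOf_schedLayout_eq I e T m _ _ _ 0 0 1 hG.1 Nat.one_pos] at h
  exact h

end Std

end SamplerRegs

end Regev2009

end Literature.Computability.Cryptography

end
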